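import Summits.ResolutionOfSingularities.ResolutionOfSingularities.Theorems.FrobeniusClosingPatchingRelPerfectDepthMultiHostFormatSnc
import Literature.AlgebraicGeometry.Resolution.KollarNmPartBlowup
import HarnessLib

/-!
# Crux `PatchingRelPerfect` (stmt-ResolutionOfSingularities-16161), chain W5.2 — F7(β) (β-AX) cures / (β′) pieces: the ONE-LINE GLUE
# from an order bound along the centre to the weight hypothesis of the monomial-sum step law

[OURS · L1 W5.2 · F7(β) (β-AX) · res-L1-w52-plan-1 NAMING G12-48 (2) / RULINGS G12-49 (1) «stub-1: YES — type the one-line glue»] res-L1-w52-stub-1 g5.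
Replaces the role of NO printed item; NOT a statement of the manuscript under review (AI-written, weaker than expert review).

G12-48 (2) asked for «END persistence under a B-permissible NON-STRATUM centre»; that is ALREADY the tree theorem
`DepthMultiHost.controlledTransform_monomialSum_of_isGenericPoint` (`…DepthMultiHostEnd` l.93, any irreducible regular centre `W` snc with the
letters, weight `ν ≤ weightAt L η` for every row `L`, `η` the generic point of `W`).  Its only hypothesis not literally among a cure's binders
is `hν`; this file supplies it from the clause currency «the order of `K` is `≥ m` at (the generic point of) `W`»:

* `le_weightAt_of_le_idealOrder_monomialSum` — `m ≤ idealOrder (monomialSum 𝒦) η ⇒ ∀ L ∈ 𝒦, m ≤ weightAt L η` (rows on an snc family);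
* `le_weightAt_of_le_idealOrder_of_stalkIdeal_eq` — the same for any `K` with `K_η = (monomialSum 𝒦)_η` (a LOCAL presentation near `η`);
* `le_weightAt_of_forall_mem_le_idealOrder` — the `W`-form: `η ∈ W` generic, `∀ y ∈ W, m ≤ idealOrder K y`.

Fact-free; three lines each (`monomialIdeal_le_monomialSum`, `idealOrder_anti`, `le_idealOrder_monomialIdeal_iff`).
-/

-- `Summit.<Summit>.<Sub>.Theorems` with `Sub = Summit` (single-conjunct summit, D-0017)
set_option linter.dupNamespace false

noncomputable section

open CategoryTheory AlgebraicGeometry TopologicalSpace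
open Literature.AlgebraicGeometry.Resolution Scheme.IdealSheafData

namespace Summit.ResolutionOfSingularities.ResolutionOfSingularities.Theorems.DepthMultiHost

universe u

variable {X : Scheme.{u}}

/-- [OURS · L1 W5.2 · glue for T1] **An order bound on a monomial sum bounds the weight of every row**: if `m ≤ ord_η(Σ_L x^L)` and the rows
live on an snc family, then `m ≤ weightAt L η` for every row `L`. [cite: BierstoneGrigorievMilmanWlodarczyk2011, §4 Step 2b] -/
theorem le_weightAt_of_le_idealOrder_monomialSum (𝒦 : List (List (X.IdealSheafData × ℕ))) (hsnc : ∀ L ∈ 𝒦, HasSNC (boundaryOf L))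
    {η : X} {m : ℕ} (hm : (m : ℕ∞) ≤ idealOrder (DepthTargets.monomialSum 𝒦) η) : ∀ L ∈ 𝒦, m ≤ weightAt L η := fun L hL =>
  (le_idealOrder_monomialIdeal_iff (hsnc L hL) m η).mp (hm.trans (Kollar2007.Triple.idealOrder_anti (monomialIdeal_le_monomialSum hL) η))

/-- [OURS · L1 W5.2 · glue for T1] The same for an ideal `K` LOCALLY presented as the monomial sum: `K_η = (Σ_L x^L)_η`. [folklore] -/
theorem le_weightAt_of_le_idealOrder_of_stalkIdeal_eq (K : X.IdealSheafData) (𝒦 : List (List (X.IdealSheafData × ℕ)))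
    (hsnc : ∀ L ∈ 𝒦, HasSNC (boundaryOf L)) {η : X} (hK : stalkIdeal K η = stalkIdeal (DepthTargets.monomialSum 𝒦) η) {m : ℕ}
    (hm : (m : ℕ∞) ≤ idealOrder K η) : ∀ L ∈ 𝒦, m ≤ weightAt L η := by
  refine le_weightAt_of_le_idealOrder_monomialSum 𝒦 hsnc ?_
  rw [le_idealOrder_iff, ← hK, ← le_idealOrder_iff]
  exact hm

/-- [OURS · L1 W5.2 · glue for T1, clause form] **`W ⊆ {ord K ≥ m}` ⇒ the weight hypothesis of
`controlledTransform_monomialSum_of_isGenericPoint`**: for `η` a (generic) point of `W`, `∀ y ∈ W, m ≤ idealOrder K y`, and `K` locally the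
monomial sum at `η`, every row has weight `≥ m` at `η`. [cite: Kollar2007, (3.111) Step 3] -/
theorem le_weightAt_of_forall_mem_le_idealOrder (K : X.IdealSheafData) (𝒦 : List (List (X.IdealSheafData × ℕ)))
    (hsnc : ∀ L ∈ 𝒦, HasSNC (boundaryOf L)) {W : Set X} {η : X} (hη : η ∈ W)
    (hK : stalkIdeal K η = stalkIdeal (DepthTargets.monomialSum 𝒦) η) {m : ℕ} (hW : ∀ y ∈ W, (m : ℕ∞) ≤ idealOrder K y) :
    ∀ L ∈ 𝒦, m ≤ weightAt L η :=
  le_weightAt_of_le_idealOrder_of_stalkIdeal_eq K 𝒦 hsnc hK (hW η hη)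

end Summit.ResolutionOfSingularities.ResolutionOfSingularities.Theorems.DepthMultiHost

end
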